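import Mathlib
import HarnessLib
import Literature.RingTheory.CohomologyAnnihilator.Completion
import Literature.AlgebraicGeometry.Resolution.AdicCompletionRegular
import Summits.ResolutionOfSingularities.ResolutionOfSingularities.Theorems.HomologicalConductorPersistenceCompletionAscentRetract
import Summits.ResolutionOfSingularities.ResolutionOfSingularities.Theorems.HomologicalConductorPersistenceCompletionAscentIsolated

set_option linter.dupNamespace false

/-!
# [BHST15, Theorem 4.5 (2)] proved: `caⁿ(R) ⊆ caⁿ⁺ᵈ(R̂) ∩ R` when `R̂` is an isolated singularity

`[OURS · L w44b · completion model, ascent half · res-type-015 gen 15]` — final brick: the NAMED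
FACT `Literature.RingTheory.CohomologyAnnihilator.le_caCompletion_comap`
([BahlekehHakimianSalarianTakahashi2015, Thm. 4.5 (2)]: for a noetherian local ring `R` of Krull
dimension `d` whose `𝔪`-adic completion `R̂ = AdicCompletion 𝔪 R` is an isolated singularity,
`caⁿ(R) ⊆ caⁿ⁺ᵈ(R̂) ∩ R` for every `n`) is DISCHARGED as `le_caCompletion_comap_holds`, helper for the
surface rung `PersistenceSurface` (stmt-ResolutionOfSingularities-19970) of crux chain w44b and for
the «C-comp» transfer of W4.4 (the conditional consequences in `Completion.lean` —
`cohomologyAnnihilator_eq_comap_completion`, `cohomologyAnnihilator_completion_eq_map`, … — can now be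
fed `caCompletion_comap_le_holds` (p512917) and `le_caCompletion_comap_holds`).  NOT a statement of the
manuscript under adjudication in cell res-hironaka.

Proof (ours; the printed proof's Cor. 4.4 is replaced by the Koszul-free
`exists_retract_baseChange_of_puncturedFree`): for `a ∈ ca^{t+1}(R)` and a `(t+d)`-th syzygy
`K = Ωᵗ W`, `W = Ωᵈ X`, over `R̂`: `W` is punctured-free (`R̂` is an isolated singularity of
dimension `d`, `…CompletionAscentIsolated`), hence a retract of `R̂ ⊗_R N`
(`…CompletionAscentRetract`, the pair `R → R̂` being flat, `𝔪R̂ = 𝔫̂`, dense); so `K` is a retract of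
`(R̂ ⊗_R Ωᵗ N) ⊕ Q` (`…CompletionAscentSyzygyRetract`); `a` stably annihilates `Ωᵗ N` (CA1 over `R`),
hence `a` stably annihilates `K`; by CA1 over `R̂` (noetherian, `Resolution.Stacks0316`),
`a ∈ ca^{t+d+1}(R̂)`.  Degree `n = 0`: `ca⁰(R) = 0`.

References: A. Bahlekeh, E. Hakimian, S. Salarian, R. Takahashi, arXiv:1504.06163, Thm. 4.5 (2)
[`BahlekehHakimianSalarianTakahashi2015`]; S. B. Iyengar, R. Takahashi, arXiv:1404.1476, §2
[`IyengarTakahashi2014`].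
-/

noncomputable section

open CategoryTheory IsLocalRing Literature.RingTheory.CohomologyAnnihilator
open Literature.AlgebraicGeometry.Resolution
open Summit.ResolutionOfSingularities.ResolutionOfSingularities.Theorems.NoZeno.SandwichCluster
open Summit.ResolutionOfSingularities.ResolutionOfSingularities.Theorems.HomologicalConductor.CompletionAscentRetract
open Summit.ResolutionOfSingularities.ResolutionOfSingularities.Theorems.HomologicalConductor.CompletionAscentIsolated
open Summit.ResolutionOfSingularities.ResolutionOfSingularities.Theorems.HomologicalConductor.CompletionAscentSyzygyRetract
open scoped TensorProduct

universe u

namespace Summit.ResolutionOfSingularities.ResolutionOfSingularities.Theorems.HomologicalConductor.CompletionAscentHolds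

/-- Splitting a syzygy chain: a `(t + d)`-th syzygy of `X` is a `t`-th syzygy of a `d`-th syzygy of
`X`. [folklore] -/
theorem exists_isSyzygy_split {S : Type u} [CommRing S] (t : ℕ) :
    ∀ (d : ℕ) {X K : ModuleCat.{u} S}, IsSyzygy (t + d) X K →
      ∃ W : ModuleCat.{u} S, IsSyzygy d X W ∧ IsSyzygy t W K
  | 0, X, _, hK => ⟨X, ⟨Iso.refl X⟩, hK⟩
  | d + 1, X, K, hK => by
    obtain ⟨X₁, h₁, hK'⟩ := isSyzygy_succ_iff_exists_first.mp
      (show IsSyzygy (t + d + 1) X K by rwa [← Nat.add_assoc] at hK)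
    obtain ⟨W, hW, hKW⟩ := exists_isSyzygy_split t d hK'
    exact ⟨W, isSyzygy_succ_iff_exists_first.mpr ⟨X₁, h₁, hW⟩, hKW⟩

/-- `R` is dense in `R̂`: every element of the completion is congruent to an element of `R` modulo
any power of the maximal ideal (`R̂/𝔪ᵏR̂ = R/𝔪ᵏ`, Mathlib's `AdicCompletion.pow_smul_top_eq_ker_eval`).
[cite: Matsumura1987, §8 (3)] -/
theorem dense_adicCompletion (R : Type u) [CommRing R] [IsNoetherianRing R] [IsLocalRing R] :
    ∀ (k : ℕ) (s : AdicCompletion (maximalIdeal R) R), ∃ r : R,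
      s - algebraMap R (AdicCompletion (maximalIdeal R) R) r ∈
        maximalIdeal (AdicCompletion (maximalIdeal R) R) ^ k := by
  intro k x
  have hfg : (maximalIdeal R).FG := (maximalIdeal R).fg_of_isNoetherianRing
  obtain ⟨r, hr⟩ := Submodule.Quotient.mk_surjective _ (x.val k)
  refine ⟨r, ?_⟩
  have hker : x - algebraMap R (AdicCompletion (maximalIdeal R) R) r ∈
      LinearMap.ker (AdicCompletion.eval (maximalIdeal R) R k) := by
    rw [LinearMap.mem_ker, map_sub, sub_eq_zero, AdicCompletion.eval_apply,
      AdicCompletion.eval_apply, AdicCompletion.algebraMap_apply, AdicCompletion.of_apply,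
      Submodule.mkQ_apply, Algebra.algebraMap_self, RingHom.id_apply]
    exact hr.symm
  rw [← AdicCompletion.pow_smul_top_eq_ker_eval (M := R) hfg, Ideal.smul_top_eq_map,
    Submodule.restrictScalars_mem] at hker
  rw [AdicCompletion.maximalIdeal_eq_map, ← Ideal.map_pow]
  exact hker

/-- **[BahlekehHakimianSalarianTakahashi2015, Theorem 4.5 (2)] PROVED** — the named fact
`Literature.RingTheory.CohomologyAnnihilator.le_caCompletion_comap` holds: for every noetherian local
ring `R` of Krull dimension `d` whose `𝔪`-adic completion `R̂` is an isolated singularity and every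
`n`, `caⁿ(R) ⊆ caⁿ⁺ᵈ(R̂) ∩ R`.  See the module docstring for the (Koszul-free) proof.
[cite: BahlekehHakimianSalarianTakahashi2015, Theorem 4.5 (2)] -/
theorem le_caCompletion_comap_holds :
    Literature.RingTheory.CohomologyAnnihilator.le_caCompletion_comap.{u} := by
  intro R _ _ _ d hd hiso n
  haveI : IsNoetherianRing (AdicCompletion (maximalIdeal R) R) :=
    isNoetherianRing_adicCompletion_maximalIdeal R
  have hmapS : (maximalIdeal R).map (algebraMap R (AdicCompletion (maximalIdeal R) R)) =
      maximalIdeal (AdicCompletion (maximalIdeal R) R) := AdicCompletion.maximalIdeal_eq_map.symm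
  have hdense := dense_adicCompletion R
  have hdS : ringKrullDim (AdicCompletion (maximalIdeal R) R) = d := by
    rw [ringKrullDim_adicCompletion, hd]
  cases n with
  | zero =>
    rw [cohomologyAnnihilatorOfDegree_zero]
    exact bot_le
  | succ t =>
    intro a ha
    rw [Ideal.mem_comap, show t + 1 + d = (t + d) + 1 by omega,
      mem_cohomologyAnnihilatorOfDegree_succ_iff_forall_isSyzygy]
    intro X K hX hK
    haveI := hX
    obtain ⟨W, hW, hKW⟩ := exists_isSyzygy_split t d hK
    haveI : Module.Finite (AdicCompletion (maximalIdeal R) R) W := finite_of_isSyzygy d hX hW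
    have hPF := puncturedFree_of_isSyzygy_of_isIsolatedSingularity hiso hdS hW
    obtain ⟨N, _, _, _, i, p, hip⟩ :=
      exists_retract_baseChange_of_puncturedFree d hmapS hdense hdS W inferInstance hPF
    have hip' : ModuleCat.ofHom i ≫ ModuleCat.ofHom p = 𝟙 W :=
      ModuleCat.hom_ext (LinearMap.ext fun w => LinearMap.congr_fun hip w)
    obtain ⟨KN, hKNfin, hKN, Q, hQ, hQproj, i', p', hip''⟩ :=
      exists_retract_baseChange_syzygy (ModuleCat.ofHom i) (ModuleCat.ofHom p) hip' t hKW
    have haKN : StablyAnnihilates R a KN :=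
      (mem_cohomologyAnnihilatorOfDegree_succ_iff_forall_isSyzygy a).mp ha _ _ inferInstance hKN
    exact StablyAnnihilates.of_retract i' p' hip''
      (StablyAnnihilates.prod_projective
        (StablyAnnihilates.baseChange (AdicCompletion (maximalIdeal R) R) haKN) hQ hQproj)

end Summit.ResolutionOfSingularities.ResolutionOfSingularities.Theorems.HomologicalConductor.CompletionAscentHolds

end
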